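import Literature.MathematicalPhysics.QuantumFieldTheory.Balaban1983to89.B8Thm2TorusCoverOfProp6DeltaA
import Literature.MathematicalPhysics.QuantumFieldTheory.Balaban1983to89.MatrixNorms
import Summits.QuantumFields.YangMills.Theorems.BalabanUVNodesN16Thm2SetupTorusOfCover
import HarnessLib

/-!
# Route `UnitScaleTilt`, crux K1 «MinimiserStabilityRegPr» (stmt-QuantumFields-19200) — THE EX DISPLAY's [Balaban1985RegularSpaces] THEOREM 2 SOCKET
# `hThm2S` IS A THEOREM FOR EVERY BLOCK SIZE `L ≥ 5`, AND THE DISPLAYED LETTER REDUCES TO ITS `L = 3` INSTANCE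

Cell `ym3-torus` ∕ fleet lead ★p1 (seat `ym-ust-19200-p1` g29, chair).  THEOREMS ONLY (0 `def`, 0 `sorry`, standard axioms); `--supports stmt-QuantumFields-19200
--as helper`; registry ∕ route ∕ display untouched (J-FREEZE honoured).

WHY.  The EX display of record S53 ✓`Prop7StubEXOfChartPiecesTwS53.stubEX_of_chartPiecesTwS53` (and every edition since S3S) carries the socket
`hThm2S : ∀ L, 1 < L → ∃ B₁ c₁ > 0, ∀ F : T3Family, F.L = L → ∀ n < K, ∃ β₀ B₂ len, Thm2SetupSUAt (F.P K) 2 (K − n) (eta F n K) β₀ B₁ B₂ c₁ len ⊤`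
= [Balaban1985RegularSpaces] Thm 2 at the `SU(2)` Setup-torus objects of every member.  Cell `lit-balaban` landed on 2026-08-29 the torus cover form of Theorem 2
WITH EVERY PER-MEMBER BINDER DISCHARGED: ✓`B8Thm2TorusCoverOfProp6DeltaA.hThm2Cover_of_prop6_deltaA` (t2s-1 g24, p720401 — «EIGHTH form, form of record of row
B8.Thm2»; inputs by name: pub-ymgap's unconditional [Balaban1985RegularSpaces] Prop. 6, p33 FILE 9 ∕ p21 FILE 10-D for (Gₛ)(Cₛ), p33∕p38's assembler road
`B9Thm310DeltaAAtMemberOfCubeData.deltaA_at_member_of_cubeData_two` for (1ₛ)(Eₛ) = [Balaban1985BackgroundPropagators] Thm 3.3 via Thm 3.10), displaying ONLY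
`4 ≤ ℓ` (`L = ℓ + 1` odd), a cyclic trace-like functional `τ` with a Cauchy–Schwarz constant, `1 ≤ M`, `0 < α < 1`, `len`, the instance binders
`[∀ i, Fintype (geo9K i).Site] [∀ i, DecidableEq (geo9K i).Site]` and numeric windows.  THIS FILE reads it in the socket's currency: the instances are
`inferInstance` after unfolding `geo9K` (its sites are the index bonds `IBondY i`), `τ := tr` with `C_τ = 2` ([Balaban1985Averaging] (20) through
✓`MatrixNorms.norm_ntr_le_opNorm`), `M := 1`, `α := 1∕2`, `len := 0`, the windows by ✓`B8Thm2TorusCoverGCOfProp6.exists_admissible_sizes_below` and three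
`min`s; the cover period descends to the member by ym-inputs p06's ✓`BalabanUVNodesN16Thm2TorusOfCover.thm2TorusAt_of_dvd'` (uniqueness half) and
✓`B8Thm2SetupTorus.thm2SetupSUAt_of_thm2TorusAt`; `F.P K = PV 2 ℓ F.m K` definitionally once `F.L = ℓ + 1` is substituted.

WHAT THIS FILE PROVES.
* §1 `abs_re_trace_star_mul_le` — `|Re tr(x⋆y)| ≤ 2‖x‖‖y‖` on `M₂(ℂ)` in the `L²`-operator norm.
* §2 ★★★★★ `thm2SetupSUAt_allMembers_of_coverForm` — for `4 ≤ ℓ`, `ℓ + 1` odd: `∃ B₁ c₁ > 0, ∀ F, F.L = ℓ + 1 → ∀ n < K, ∃ β₀ B₂ len, Thm2SetupSUAt (F.P K) 2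
  (K − n) (eta F n K) β₀ B₁ B₂ c₁ len ⊤` — NO displayed hypothesis.
* §3 ★★★★★ `hThm2S_body_of_five_le` — the socket's body for EVERY `L ≥ 5` (even `L`: no `T3Family` member, vacuous).
* §4 ★★★★★ `hThm2S_of_three` — the displayed letter `hThm2S` VERBATIM (S53 :223 binder text) from its `L = 3` instance alone.

HONEST SCOPE.  Plumbing over landed theorems by name; every estimate of print is inside the cover form's imports (cells lit-balaban ∕ pub-ymgap ∕ ym-inputs);
the `L = 3` members (`T3Family.hL : Odd L ∧ 1 < L` admits them) are NOT served — lit-balaban's cover chain carries `4 ≤ ℓ` (its L3 re-edition is their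
docket); so `hThm2S` as displayed is NOT discharged, EX `stub_existenceMinimalOrbit` ∕ the crux ∕ R3 are NOT proved; rung R3 = SU(2) YM₃ on T³ —
NOT d = 4, NOT infinite volume, NOT a mass gap, NOT Clay; the Yang–Mills mass gap is NOT proved.
References: T. Bałaban, CMP **99** (1985) 75–102 [Balaban1985RegularSpaces] (Thm 2 p.83, (1.33)–(1.39) pp.82–83, Prop. 6 p.99, p.77); CMP **99** (1985) 389–434
[Balaban1985BackgroundPropagators] (Thm 3.3 p.399, Thm 3.10 pp.414–416, (3.42) p.397); CMP **98** (1985) 17–51 [Balaban1985Averaging] ((20) p.21);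
CMP **102** (1985) 255–275 [Balaban1985UV3] ((1)–(3) p.256); CMP **102** (1985) 277–309 [Balaban1985Variational] ((2), (5) p.278).
-/

set_option autoImplicit false

noncomputable section

open scoped BigOperators Matrix Matrix.Norms.L2Operator

namespace Summit.QuantumFields.YangMills.Theorems.Prop7Thm2SocketOfCoverForm

open Literature.MathematicalPhysics.QuantumFieldTheory.Balaban1983to89
open B7Prop1Explicit renaming Site → LSite
open B6KLevelCensusIndexV1 (KIdx)
open B9GeoNormsKLevelV1 (geo9K)
open B6GlobalChartV1 (PV)
open B9Eq316AveragingTransposeZd (betaTau alphaQ)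
open B7Prop2Explicit (C0 c2')
open B7Prop2SpecialUnitary (specialUnitaryUnits specialUnitaryUnits_le_unitaryUnits)
open B8Thm2TorusAt (Thm2TorusAt)
open B8Thm2SetupTorus (Thm2SetupSUAt thm2SetupSUAt_of_thm2TorusAt)
open B8Thm2TorusCoverOfProp6DeltaA (hThm2Cover_of_prop6_deltaA)
open B8Thm2TorusCoverGCOfProp6 (exists_admissible_sizes_below)
open T3ContinuumYM3Torus (T3Family)
open T3SectALandauChart (eta eta_pos)
open Summit.QuantumFields.YangMills.BalabanUVNodes.N16.Thm2TorusOfCover (thm2TorusAt_of_dvd')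

/-! ## §1 The trace functional of record on `M₂(ℂ)`: `C_τ = 2` -/

/-- `|Re tr(x⋆y)| ≤ 2‖x‖‖y‖` on `M₂(ℂ)` in the `L²`-operator norm — [Balaban1985Averaging] (20) «|tr X| ≤ |X|» for the normalised trace (✓`MatrixNorms.norm_ntr_le_opNorm`),
sub-multiplicativity and `‖x⋆‖ = ‖x‖`. [cite: Balaban1985Averaging, (20) p.21] -/
theorem abs_re_trace_star_mul_le (x y : Matrix (Fin 2) (Fin 2) ℂ) :
    |((Matrix.traceLinearMap (Fin 2) ℂ ℂ) (star x * y)).re| ≤ 2 * ‖x‖ * ‖y‖ := by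
  rw [Matrix.traceLinearMap_apply]
  have h1 : |(Matrix.trace (star x * y)).re| ≤ ‖Matrix.trace (star x * y)‖ := Complex.abs_re_le_norm _
  have h2 : ‖Matrix.trace (star x * y)‖ ≤ 2 * ‖star x * y‖ := by
    have h := MatrixNorms.norm_ntr_le_opNorm (star x * y)
    rw [MatrixNorms.ntr, Fintype.card_fin, norm_div, Nat.cast_ofNat, Complex.norm_ofNat] at h
    linarith [div_le_iff₀ (by norm_num : (0:ℝ) < 2) |>.mp h]
  have h3 : ‖star x * y‖ ≤ ‖x‖ * ‖y‖ := (norm_mul_le _ _).trans_eq (by rw [norm_star])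
  calc |(Matrix.trace (star x * y)).re| ≤ 2 * ‖star x * y‖ := h1.trans h2
    _ ≤ 2 * (‖x‖ * ‖y‖) := mul_le_mul_of_nonneg_left h3 (by norm_num)
    _ = 2 * ‖x‖ * ‖y‖ := (mul_assoc _ _ _).symm

/-- The trace is cyclic (bookkeeping for the cover form's `hτt`). [cite: Balaban1985BackgroundPropagators, p.391 («X·Y = tr XY»)] -/
theorem trace_mul_comm_two (a b : Matrix (Fin 2) (Fin 2) ℂ) :
    (Matrix.traceLinearMap (Fin 2) ℂ ℂ) (a * b) = (Matrix.traceLinearMap (Fin 2) ℂ ℂ) (b * a) := by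
  rw [Matrix.traceLinearMap_apply, Matrix.traceLinearMap_apply, Matrix.trace_mul_comm]

/-! ## §2 ★★★★★ [B8] Theorem 2 at every `SU(2)` Setup-torus member of block size `L = ℓ + 1 ≥ 5` (odd), uniform `B₁, c₁` — no displayed hypothesis -/

/-- ★★★★★ **[Balaban1985RegularSpaces] THEOREM 2 AT THE `SU(2)`-VALUED SETUP-TORUS OBJECTS OF EVERY MEMBER `(F, n, K)`, `F.L = ℓ + 1` ODD, `4 ≤ ℓ` — UNIFORM `B₁, c₁`,
NO DISPLAYED HYPOTHESIS.**  lit-balaban's binder-free cover form ✓`hThm2Cover_of_prop6_deltaA` read at `τ := tr` (`C_τ = 2`, §1), `M := 1`, `α := 1∕2`, `len := 0`,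
with the `Fintype`∕`DecidableEq` structures on the index bonds `(geo9K i).Site = IBondY i` by `inferInstance`, its numeric windows inhabited by
✓`exists_admissible_sizes_below` and three `min`s; the conclusion `Thm2TorusAt (ℓ+1) (K−n) P′ …` at the `L^{k₀}`-fold cover's period `P′` (`P ∣ P′`, `L^{K−n} ∣ P`)
descends to the member's period `P = (F.P K).sitesPerDir 0` through the uniqueness half (ym-inputs ✓`thm2TorusAt_of_dvd'`, window constant `min c₁ (16B₁)⁻¹`)
and to the Setup currency by ✓`thm2SetupSUAt_of_thm2TorusAt`; `β₀ := 0`. [cite: Balaban1985RegularSpaces, Thm 2 p.83, (1.33)–(1.39) pp.82–83, Prop. 6 (1.135)–(1.138) p.99, p.77 («Ω_j = T_η»); Balaban1985BackgroundPropagators, Thm 3.3 p.399, Thm 3.10 (3.105)–(3.106) pp.414–416; Balaban1985UV3, (1)–(3) p.256; Balaban1985Variational, (2), (5) p.278] -/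
theorem thm2SetupSUAt_allMembers_of_coverForm {ℓ : ℕ} (hℓ : 4 ≤ ℓ) (hodd : Odd (ℓ + 1)) :
    ∃ B₁ c₁ : ℝ, 0 < B₁ ∧ 0 < c₁ ∧ ∀ (F : T3Family), F.L = ℓ + 1 → ∀ (n K : ℕ), n < K →
      ∃ (β₀ B₂ : ℝ) (len : LSite (F.P K).d → ℝ),
        Thm2SetupSUAt (F.P K) 2 (K - n) (eta F n K) β₀ B₁ B₂ c₁ len (fun _ => True) := by
  letI : CStarAlgebra (Matrix (Fin 2) (Fin 2) ℂ) := {}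
  have hL : Odd (ℓ + 1) ∧ 1 < ℓ + 1 := ⟨hodd, by omega⟩
  have hd₃ : 1 ≤ 2 + 1 := by norm_num
  -- the instance binders of the cover form: the sites of `geo9K i` are the index bonds
  haveI instF : ∀ i : KIdx 2 ℓ hd₃ hL 1 1, Fintype (geo9K i).Site := fun i => by
    unfold B9GeoNormsKLevelV1.geo9K; infer_instance
  haveI instD : ∀ i : KIdx 2 ℓ hd₃ hL 1 1, DecidableEq (geo9K i).Site := fun i => by
    unfold B9GeoNormsKLevelV1.geo9K; infer_instance
  -- the cover form at `τ := tr`, `C_τ := 2`, `M := 1`, `α := 1/2`, `len := 0`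
  obtain ⟨δE, hδE, d', A₀, H1⟩ := hThm2Cover_of_prop6_deltaA (hL := hL) (hd₃ := hd₃) (len := fun _ => (0 : ℝ)) hℓ
    (Matrix.traceLinearMap (Fin 2) ℂ ℂ) (fun a => Matrix.traceLinearMap_apply _ _ _ a) trace_mul_comm_two
    (Cτ := 2) abs_re_trace_star_mul_le (M := 1) le_rfl (α := 1 / 2) (by norm_num) (by norm_num)
  obtain ⟨cP, hcP, BE, hBE, aJ, haJ, H2⟩ := H1 A₀ le_rfl
  -- the `a_T` ∕ `α₀′` windows
  obtain ⟨α₀', aT, haT, h1, h2, h3, h4, h5, hα₀', h6, h7, h8, h9⟩ :=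
    exists_admissible_sizes_below (2 + 1) (L := ℓ + 1) (by omega)
      (48 * (((2 : ℕ) : ℝ) + 1) + 14 * ((2 : ℕ) : ℝ) * (1 : ℝ) + (32 * (((2 : ℕ) : ℝ) + 2) ^ 2 +
        12 * (((2 : ℕ) : ℝ) + 1) ^ 2 * (13344 * (((2 : ℕ) : ℝ) + 1) * (((2 : ℕ) : ℝ) + 2) ^ 2 * (((2 : ℕ) : ℝ) + 5) * (((ℓ + 1 : ℕ) : ℝ)) ^ (2 + 4)) *
          ((2 : ℝ) * betaTau (Matrix.traceLinearMap (Fin 2) ℂ ℂ))))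
      (2 * (BE * B6.c1 d' δE (1 - 1 / 2) * (((ℓ + 1 : ℕ) : ℝ)) ^ 4)) haJ hcP
  obtain ⟨a₀', ha₀', k₀, cα, hcα, H3⟩ := H2 aT haT h1 h2 h3 h4 h5 α₀' hα₀' h6 h7 h8 h9
  -- the `c_L` windows
  have hLpos : (0 : ℝ) < ((ℓ + 1 : ℕ) : ℝ) := by positivity
  have hL2 : (0 : ℝ) < (((ℓ + 1 : ℕ) : ℝ)) ^ 2 := by positivity
  have hden : (0 : ℝ) < 2 * (2 * (2 * (BE * B6.c1 d' δE (1 - 1 / 2) * (((ℓ + 1 : ℕ) : ℝ)) ^ 4))) * (14 * ((2 + 1 - 1 : ℕ) : ℝ)) * (1 : ℝ) + 1 := by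
    have hc1 : 0 ≤ B6.c1 d' δE (1 - 1 / 2) := B6RandomWalk.c1_nonneg d' δE _
    positivity
  set W : ℝ := min (1 / 16) (min aT (min aT (1 / (2 * (2 * (2 * (BE * B6.c1 d' δE (1 - 1 / 2) * (((ℓ + 1 : ℕ) : ℝ)) ^ 4))) *
    (14 * ((2 + 1 - 1 : ℕ) : ℝ)) * (1 : ℝ) + 1)))) with hW
  have hWpos : 0 < W := by
    rw [hW]; exact lt_min (by norm_num) (lt_min haT (lt_min haT (one_div_pos.mpr hden)))
  set cL : ℝ := min (a₀' / (2 * (((ℓ + 1 : ℕ) : ℝ)) ^ 2)) (min W cα) with hcL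
  have hcL0 : 0 < cL := by rw [hcL]; exact lt_min (by positivity) (lt_min hWpos hcα)
  have hcL1 : cL * (((ℓ + 1 : ℕ) : ℝ)) ^ 2 < a₀' := by
    have : cL ≤ a₀' / (2 * (((ℓ + 1 : ℕ) : ℝ)) ^ 2) := by rw [hcL]; exact min_le_left _ _
    calc cL * (((ℓ + 1 : ℕ) : ℝ)) ^ 2 ≤ a₀' / (2 * (((ℓ + 1 : ℕ) : ℝ)) ^ 2) * (((ℓ + 1 : ℕ) : ℝ)) ^ 2 :=
          mul_le_mul_of_nonneg_right this hL2.le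
      _ = a₀' / 2 := by field_simp
      _ < a₀' := by linarith
  have hcL2 : cL ≤ W := by rw [hcL]; exact (min_le_right _ _).trans (min_le_left _ _)
  have hcL3 : cL ≤ cα := by rw [hcL]; exact (min_le_right _ _).trans (min_le_right _ _)
  obtain ⟨B₁', B₂, c₁, hB₁', hB₂, hc₁, H4⟩ := H3 cL hcL0 hcL1 (by rw [hW] at hcL2; exact hcL2) hcL3
  refine ⟨B₁', min c₁ (16 * B₁')⁻¹, hB₁', lt_min hc₁ (by positivity), fun F hF n K hnK => ?_⟩
  obtain ⟨hdvd, hpow, hT⟩ := H4 F hF n K hnK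
  -- descend from the cover period to the member's own period (uniqueness half), then to the Setup currency
  obtain ⟨L', hL', m, hm⟩ := F
  subst hF
  haveI : Nonempty (Fin 2) := ⟨0⟩
  have hT' := thm2TorusAt_of_dvd' (n := Fin 2) (L := ℓ + 1) (by omega) hdvd hpow (eta_pos _ n K) hB₁'
    specialUnitaryUnits_le_unitaryUnits hT
  exact ⟨0, B₂, fun _ => (0 : ℝ), thm2SetupSUAt_of_thm2TorusAt hT'⟩

/-! ## §3 ★★★★★ The socket's body for every block size `L ≥ 5` -/

/-- ★★★★★ **THE BODY OF THE EX DISPLAY's SOCKET `hThm2S` HOLDS FOR EVERY `L ≥ 5`**: odd `L` by §2 (`L = ℓ + 1`, `4 ≤ ℓ`); even `L` carries no `T3Family` member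
(`T3Family.hL : Odd L ∧ 1 < L`), so the member clause is vacuous (`B₁ = c₁ = 1`). [cite: Balaban1985RegularSpaces, Thm 2 p.83; Balaban1985UV3, (1)–(3) p.256] -/
theorem hThm2S_body_of_five_le (L : ℕ) (hL5 : 5 ≤ L) :
    ∃ B₁ c₁ : ℝ, 0 < B₁ ∧ 0 < c₁ ∧ ∀ (F : T3Family), F.L = L → ∀ (n K : ℕ), n < K →
      ∃ (β₀ B₂ : ℝ) (len : LSite (F.P K).d → ℝ),
        Thm2SetupSUAt (F.P K) 2 (K - n) (eta F n K) β₀ B₁ B₂ c₁ len (fun _ => True) := by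
  rcases Nat.even_or_odd L with hev | hodd
  · refine ⟨1, 1, one_pos, one_pos, fun F hF n K hnK => ?_⟩
    exact absurd (hF ▸ F.hL.1) (Nat.not_odd_iff_even.mpr hev)
  · obtain ⟨ℓ, rfl⟩ : ∃ ℓ, L = ℓ + 1 := ⟨L - 1, by omega⟩
    exact thm2SetupSUAt_allMembers_of_coverForm (by omega) hodd

/-! ## §4 ★★★★★ The displayed letter `hThm2S` from its `L = 3` instance alone -/

/-- ★★★★★ **THE EX DISPLAY's SOCKET `hThm2S` (S53 :223, VERBATIM) FROM ITS `L = 3` INSTANCE ALONE**: `L = 2, 4` carry no member (even), `L ≥ 5` is §3, `L = 3` is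
the hypothesis — the one member class lit-balaban's cover chain (`4 ≤ ℓ`) does not serve.  CONDITIONAL on that instance; nothing of it is proved here.
[cite: Balaban1985RegularSpaces, Thm 2 p.83; Balaban1985UV3, (1)–(3) p.256] -/
theorem hThm2S_of_three
    (h3 : ∃ B₁ c₁ : ℝ, 0 < B₁ ∧ 0 < c₁ ∧ ∀ (F : T3Family), F.L = 3 → ∀ (n K : ℕ), n < K →
      ∃ (β₀ B₂ : ℝ) (len : LSite (F.P K).d → ℝ),
        Thm2SetupSUAt (F.P K) 2 (K - n) (eta F n K) β₀ B₁ B₂ c₁ len (fun _ => True)) :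
    ∀ (L : ℕ), 1 < L → ∃ B₁ c₁ : ℝ, 0 < B₁ ∧ 0 < c₁ ∧ ∀ (F : T3Family), F.L = L → ∀ (n K : ℕ), n < K →
      ∃ (β₀ B₂ : ℝ) (len : B7Prop1Explicit.Site (F.P K).d → ℝ),
        Thm2SetupSUAt (F.P K) 2 (K - n) (eta F n K) β₀ B₁ B₂ c₁ len (fun _ => True) := by
  intro L hL
  by_cases h5 : 5 ≤ L
  · exact hThm2S_body_of_five_le L h5
  by_cases hL3 : L = 3
  · subst hL3; exact h3
  · -- `L ∈ {2, 4}`: even, no member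
    refine ⟨1, 1, one_pos, one_pos, fun F hF n K hnK => ?_⟩
    have hev : Even L := by
      rcases (show L = 2 ∨ L = 4 by omega) with h | h <;> subst h <;> decide
    exact absurd (hF ▸ F.hL.1) (Nat.not_odd_iff_even.mpr hev)

end Summit.QuantumFields.YangMills.Theorems.Prop7Thm2SocketOfCoverForm

end
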